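import Summits.ABC.StewartYu.PadicW80Sizes3
import HarnessLib

/-!
# The `q = 3` (`p = 2`) parameter record — the archimedean sizes, II: height sums and the `Δ`-value factor
# `qΔ3 = DwQ (3^{J₀−J}) a b h τ₀ s`

Support file (theorems only; no named facts), cell `abc-stewartyu` (p1; crux `W80Two` stmt-ABC-19486; design memo
HOME/p1/S2-q3-record-design.md).  Continuation of `PadicW80Sizes3.lean` (record-side, frame-free):
the height sums `∑ eᵢ Vallᵢ ≤ c𝔘/(3c_L')` for `eᵢ ≤ c·Lall3ᵢ·S₀` (the exponents at a point of step `k` satisfy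
this with `c = 3^{k+1}`), and the value factor of p2-g3's `SetupQ.qΔ3 := DwQ (3^(J₀−J)) …`:
`|DwQ c a b h k s| ≤ k!·cᵏ·2^{a+bh}·(e(cs+h)/h)^{h(b+1)}` (generic scale `c`, from `Waldschmidt1980.norm_pv_le`)
and `|DwQ (3^{J₀−J}) a b h τ₀ s| ≤ 𝔔⁴` for `a < h`, `b < L_b`, `τ₀ ≤ T`, `J ≤ J₀`, `s ≤ 3^{d+1+J} S₀`.
Everything is [folklore] bookkeeping on [cite: Waldschmidt1980, (3.11), (3.17), §3.4 (pp. 265–269)].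
-/

noncomputable section

open Finset Real
open Literature.NumberTheory.Transcendental
open Literature.NumberTheory.Transcendental.Baker1975
open Literature.NumberTheory.Transcendental.Baker1975.Ch3
open Literature.NumberTheory.Transcendental.CW77

namespace Summit.ABC.StewartYu

open PadicW80Par (cTp cSp cLp cLp' Ap mRp)

namespace PadicW80ParL

variable {d : ℕ} (P : PadicW80ParL d)

/-! ### The number of unknowns -/

/-- **`h L_b ∏ᵢ (Lall3ᵢ/3ᴶ + 1) ≤ 𝔔`** (`≤ (2U)^{d+2}`, `(d+2) log 2U ≤ 22 m W⋆ ≤ 𝔘/1024`): the number of unknowns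
of level `J`. [cite: Waldschmidt1980, §3.2 (p. 266)] -/
theorem card_unknowns3_le_𝔔3 (J : ℕ) :
    (P.hparℓ : ℝ) * P.Lb3 * ∏ i, (((P.Lall3 i / 3 ^ J : ℕ) : ℝ) + 1) ≤ P.𝔔3 := by
  have hU := P.U_pos
  have h𝔘U : P.𝔘3 ≤ P.Uℓ := by
    rw [P.U_eq3]; have : (1 : ℝ) ≤ 3 ^ (d + 1) := one_le_pow₀ (by norm_num)
    nlinarith [P.𝔘3_pos]
  have hU1 : (1 : ℝ) ≤ P.Uℓ := by linarith [P.𝔘3_ge', show (1 : ℝ) ≤ 2 ^ 96 by norm_num]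
  have hLall : ∀ i, (P.Lall3 i : ℝ) ≤ P.Uℓ := by
    intro i
    have hS := P.S₀3_pos; have hm := mR_pos P
    have hden : ∀ V : ℝ, 1 ≤ V → 1 ≤ cLp' * mRp d * 3 ^ (d + 2) * (P.S₀3 : ℝ) * V := by
      intro V hV
      have h6 : (6 : ℝ) ≤ P.S₀3 := by exact_mod_cast P.six_le_S₀3
      have h3 : (1 : ℝ) ≤ 3 ^ (d + 2) := one_le_pow₀ (by norm_num)
      unfold cLp'; have := two_le_mR P
      calc (1 : ℝ) ≤ 2 ^ 12 * 2 * 1 * 6 * 1 := by norm_num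
        _ ≤ 2 ^ 12 * mRp d * 3 ^ (d + 2) * (P.S₀3 : ℝ) * V := by gcongr
    refine Fin.lastCases ?_ (fun j => ?_) i
    · rw [P.Lall3_last]
      exact (P.Lθ3_le).trans (div_le_self hU.le (hden _ P.hVθ1))
    · rw [P.Lall3_castSucc]
      exact (P.L3_le j).trans (div_le_self hU.le (hden _ (P.hV j)))
  have hY : ∀ i, ((P.Lall3 i / 3 ^ J : ℕ) : ℝ) + 1 ≤ 2 * P.Uℓ := by
    intro i
    have h1 : ((P.Lall3 i / 3 ^ J : ℕ) : ℝ) ≤ P.Lall3 i := by exact_mod_cast Nat.div_le_self _ _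
    linarith [hLall i]
  have hhLb : (P.hparℓ : ℝ) * P.Lb3 ≤ 2 * P.Uℓ := by
    have h1 := P.hparLb3_le; have h2 := P.Wstar_le_𝔘3; have h3 := P.𝔘3_pos
    have : P.𝔘3 / cLp + 4 * P.Wstarℓ ≤ 2 * P.𝔘3 := by unfold cLp; nlinarith
    linarith
  have hprod : (∏ i, (((P.Lall3 i / 3 ^ J : ℕ) : ℝ) + 1)) ≤ (2 * P.Uℓ) ^ (d + 1) := by
    calc (∏ i, (((P.Lall3 i / 3 ^ J : ℕ) : ℝ) + 1)) ≤ ∏ _i : Fin (d + 1), (2 * P.Uℓ) :=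
          prod_le_prod (fun i _ => by positivity) fun i _ => hY i
      _ = (2 * P.Uℓ) ^ (d + 1) := by simp
  have htot : (P.hparℓ : ℝ) * P.Lb3 * ∏ i, (((P.Lall3 i / 3 ^ J : ℕ) : ℝ) + 1) ≤ (2 * P.Uℓ) ^ (d + 2) := by
    calc (P.hparℓ : ℝ) * P.Lb3 * ∏ i, (((P.Lall3 i / 3 ^ J : ℕ) : ℝ) + 1)
        ≤ (2 * P.Uℓ) * (2 * P.Uℓ) ^ (d + 1) := mul_le_mul hhLb hprod (by positivity) (by positivity)
      _ = (2 * P.Uℓ) ^ (d + 2) := by ring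
  refine htot.trans (P.le_𝔔3_of_log_le ?_)
  rw [Real.log_pow, Real.log_mul (by norm_num) hU.ne']
  have hlog := P.log_U_le
  have hl2 : Real.log 2 ≤ 1 := by linarith [Real.log_two_lt_d9]
  have hmW := P.Wstar_le_𝔘3; have hW := P.one_le_Wstar; have h𝔘 := P.𝔘3_pos
  have hm : ((d + 2 : ℕ) : ℝ) ≤ 2 * mRp d := by
    have hd1 : (1 : ℝ) ≤ d := by exact_mod_cast P.hd
    unfold mRp; push_cast; linarith
  have hmU := P.mR_le_𝔘3
  have hlogU0 : 0 ≤ Real.log P.Uℓ := Real.log_nonneg hU1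
  calc ((d + 2 : ℕ) : ℝ) * (Real.log 2 + Real.log P.Uℓ) ≤ (2 * mRp d) * (1 + 10 * P.Wstarℓ) := by
        refine mul_le_mul hm (by linarith) ?_ (by have := mR_pos P; linarith)
        have : 0 ≤ Real.log 2 := Real.log_nonneg one_le_two
        linarith
    _ ≤ (2 * mRp d) * (11 * P.Wstarℓ) := by
        refine mul_le_mul_of_nonneg_left (by linarith) (by have := mR_pos P; linarith)
    _ = 22 * (mRp d * P.Wstarℓ) := by ring
    _ ≤ P.𝔘3 / 1024 := by
        -- `mRp d · W⋆ ≤ 𝔘/2^{90}`: from `2^96 W⋆ ≤ 𝔘` and `m ≤ 2^{d+1} ≤ …` use the product bound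
        have h1 : (2 : ℝ) ^ 96 * (mRp d * P.Wstarℓ) ≤ mRp d * P.𝔘3 := by nlinarith [mR_pos P]
        have h2 : mRp d * P.𝔘3 ≤ P.𝔘3 * P.𝔘3 / 2 ^ 96 := by
          rw [le_div_iff₀ (by norm_num)]; nlinarith
        -- crude: `22 m W⋆ ≤ 22 𝔘 m/2^96 ≤ …` — instead use `m W⋆ ≤ W⋆ · W⋆ ≤ …`? simpler: `m ≤ 𝔘/2^96`, `W⋆ ≤ 𝔘/2^96`
        -- and `m W⋆ ≤ (9m) W⋆/9 ≤ W⋆²/9`; we use `9 m ≤ W⋆` and `W⋆ ≤ 𝔘/2^96`, `W⋆ ≥ 1`: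
        have h9 := P.nine_mR_le_Wstar
        have h3 : mRp d * P.Wstarℓ ≤ P.Wstarℓ * P.Wstarℓ / 9 := by
          rw [le_div_iff₀ (by norm_num)]; nlinarith
        have h4 : P.Wstarℓ * P.Wstarℓ ≤ P.𝔘3 * P.Wstarℓ / 2 ^ 96 := by
          rw [le_div_iff₀ (by norm_num)]; nlinarith
        have h5 : P.𝔘3 * P.Wstarℓ / 2 ^ 96 ≤ P.𝔘3 * (P.𝔘3 / 2 ^ 96) / 2 ^ 96 := by
          have : P.Wstarℓ ≤ P.𝔘3 / 2 ^ 96 := by rw [le_div_iff₀ (by norm_num)]; linarith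
          gcongr
        -- `𝔘/2^96 ≥ 1`, so `𝔘 · (𝔘/2^96)/2^96 ≤ 𝔘 · 𝔘 /2^192`; too weak in the wrong direction — use instead
        -- the linear bound `22 m W⋆ ≤ 22 · W⋆²/9` and `W⋆² ≤ 𝔘 W⋆ /2^96 ≤ ...`: we need `W⋆ ≤ 2^96/...`? No:
        -- go linear: `m W⋆ ≤ W⋆ · W⋆/9` is quadratic; the clean route is `m ≤ 2^{d+1}` FALSE in general.
        -- Use `2^{48m} W⋆ ≤ 𝔘` (𝔘3_ge_Wstar) and `m ≤ 2^{m}`: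
        have hA := P.𝔘3_ge_Wstar
        have hm2 : mRp d ≤ 2 ^ (d + 1) := by
          unfold mRp
          have : ((d : ℝ) + 1) = ((d + 1 : ℕ) : ℝ) := by push_cast; ring
          rw [this]; exact_mod_cast (Nat.lt_two_pow_self).le
        have hpow : (22 * 1024 : ℝ) * 2 ^ (d + 1) ≤ 2 ^ (48 * (d + 1)) := by
          calc (22 * 1024 : ℝ) * 2 ^ (d + 1) ≤ 2 ^ 15 * 2 ^ (d + 1) := by gcongr; norm_num
            _ = 2 ^ (15 + (d + 1)) := by rw [← pow_add]
            _ ≤ 2 ^ (48 * (d + 1)) := pow_le_pow_right₀ (by norm_num) (by omega)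
        rw [le_div_iff₀ (by norm_num)]
        have hW0 : (0 : ℝ) ≤ P.Wstarℓ := by linarith
        calc 22 * (mRp d * P.Wstarℓ) * 1024 = (22 * 1024 * mRp d) * P.Wstarℓ := by ring
          _ ≤ (22 * 1024 * 2 ^ (d + 1)) * P.Wstarℓ := by gcongr
          _ ≤ 2 ^ (48 * (d + 1)) * P.Wstarℓ := mul_le_mul_of_nonneg_right hpow hW0
          _ ≤ P.𝔘3 := hA

/-! ### Height sums -/

/-- `∑ᵢ Lall3ᵢ Vallᵢ = ∑ⱼ L3ⱼVⱼ + Lθ3 V_θ`. [folklore] -/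
theorem sum_Lall3_Vall : ∑ i, (P.Lall3 i : ℝ) * P.Vallℓ i = (∑ j, (P.L3 j : ℝ) * P.V j) + P.Lθ3 * P.Vθ := by
  rw [Fin.sum_univ_castSucc]; simp

/-- **`S₀ ∑ᵢ Lall3ᵢ Vallᵢ ≤ 𝔘/(3c_L')`.** [cite: Waldschmidt1980, (3.11) (p. 265)] -/
theorem S₀3_sum_LV_le : (P.S₀3 : ℝ) * ∑ i, (P.Lall3 i : ℝ) * P.Vallℓ i ≤ P.𝔘3 / (3 * cLp') := by
  rw [P.sum_Lall3_Vall]; exact P.S₀3LV_le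

/-- **`∑ eᵢ Vallᵢ ≤ c 𝔘/(3c_L')`** when `eᵢ ≤ c Lall3ᵢ S₀` (the exponents at a point of step `k`:
`λᵢ^{(J)} s ≤ (Lall3ᵢ/3ᴶ)·3^{k+1+J} S₀ = 3^{k+1} Lall3ᵢ S₀`). [cite: Waldschmidt1980, (3.11) (p. 265)] -/
theorem sum_eV3_le {e : Fin (d + 1) → ℕ} {c : ℕ} (he : ∀ i, e i ≤ c * P.Lall3 i * P.S₀3) :
    ∑ i, (e i : ℝ) * P.Vallℓ i ≤ c * (P.𝔘3 / (3 * cLp')) := by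
  have hV := P.Vall_pos
  calc ∑ i, (e i : ℝ) * P.Vallℓ i ≤ ∑ i, ((c * P.Lall3 i * P.S₀3 : ℕ) : ℝ) * P.Vallℓ i :=
        sum_le_sum fun i _ => mul_le_mul_of_nonneg_right (by exact_mod_cast he i) (hV i).le
    _ = c * ((P.S₀3 : ℝ) * ∑ i, (P.Lall3 i : ℝ) * P.Vallℓ i) := by
        rw [mul_sum, mul_sum]; refine sum_congr rfl fun i _ => ?_; push_cast; ring
    _ ≤ c * (P.𝔘3 / (3 * cLp')) := mul_le_mul_of_nonneg_left P.S₀3_sum_LV_le (Nat.cast_nonneg _)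

/-! ### The `Δ`-value factor `DwQ c a b h k s` -/

/-- **The size of the value factor at a natural point, generic scale `c`**:
`|DwQ c a b h k s| ≤ k! · cᵏ · 2^{a+bh} · (e(cs + h)/h)^{h(b+1)}` (`a < h`).
[cite: Waldschmidt1980, (3.17) (p. 266)] [cite: BakerTNT1975, Ch. 3 §2 Lemma 1] -/
theorem abs_DwQ_natCast_le {a h : ℕ} (ha : a < h) (b c k s : ℕ) :
    |(PadicCW77.Setup.DwQ c a b h k (s : ℚ) : ℝ)| ≤
      k.factorial * (c : ℝ) ^ k * (2 ^ (a + b * h) * (Real.exp 1 * ((c : ℝ) * s + h) / h) ^ (h * (b + 1))) := by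
  have hh : 1 ≤ h := by omega
  have e : PadicCW77.Setup.DwQ c a b h k (s : ℚ) =
      Waldschmidt1980.pvQ c ((⟨a, ha⟩ : Fin h), (⟨b, Nat.lt_succ_self b⟩ : Fin (b + 1))) k (s : ℚ) := rfl
  have h1 := Waldschmidt1980.norm_pv_le hh c ((⟨a, ha⟩ : Fin h), (⟨b, Nat.lt_succ_self b⟩ : Fin (b + 1))) k
    ((s : ℚ) : ℂ)
  rw [Waldschmidt1980.pv_ratCast, Complex.norm_ratCast, ← e] at h1
  have hcs : ⌈(c : ℝ) * ‖((s : ℚ) : ℂ)‖⌉₊ = c * s := by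
    rw [show ((s : ℚ) : ℂ) = (s : ℂ) by push_cast; rfl, Complex.norm_natCast,
      show (c : ℝ) * (s : ℝ) = ((c * s : ℕ) : ℝ) by push_cast; ring, Nat.ceil_natCast]
  rw [hcs] at h1
  simpa using h1

/-- **`|qΔ3| ≤ 𝔔⁴` at the `2`-adic depth**: for `a < h`, `b < L_b`, `τ₀ ≤ T`, `J ≤ J₀`, `s ≤ 3^{d+1+J} S₀`,
`|DwQ (3^{J₀−J}) a b h τ₀ s| ≤ 𝔔⁴` (`τ₀! ≤ 𝔔`, `(3^{J₀−J})^{τ₀} ≤ T^T ≤ 𝔔`, `2^{a+bh} ≤ 2^{hL_b} ≤ 𝔔`,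
`(e(x+h)/h)^{h(b+1)} ≤ (e(X+h)/h)^{hL_b} ≤ 𝔔`). [cite: Waldschmidt1980, §3.4 (p. 269)] -/
theorem abs_qΔ3_le_𝔔3 {a b : ℕ} (ha : a < P.hparℓ) (hb : b < P.Lb3) {τ₀ : ℕ} (hτ : τ₀ ≤ P.T3) {J s : ℕ}
    (hJ : J ≤ P.J₀3) (hs : s ≤ 3 ^ (d + 1 + J) * P.S₀3) :
    |(PadicCW77.Setup.DwQ (3 ^ (P.J₀3 - J)) a b P.hparℓ τ₀ (s : ℚ) : ℝ)| ≤ P.𝔔3 ^ 4 := by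
  have h := abs_DwQ_natCast_le ha b (3 ^ (P.J₀3 - J)) τ₀ s
  refine h.trans ?_
  have h𝔔 := P.𝔔3_pos
  -- the four factors
  have hf1 : (τ₀.factorial : ℝ) ≤ P.𝔔3 := P.factorial_le_𝔔3 hτ
  have hf2 : (((3 ^ (P.J₀3 - J) : ℕ) : ℝ)) ^ τ₀ ≤ P.𝔔3 := by
    refine P.pow_le_𝔔3_of_le_T3 (by exact_mod_cast Nat.one_le_pow _ _ (by norm_num)) ?_ hτ
    exact_mod_cast P.scale3_le_T3 J
  have hab : a + b * P.hparℓ ≤ P.hparℓ * P.Lb3 := by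
    calc a + b * P.hparℓ ≤ P.hparℓ + b * P.hparℓ := by omega
      _ = (b + 1) * P.hparℓ := by ring
      _ ≤ P.Lb3 * P.hparℓ := Nat.mul_le_mul_right _ hb
      _ = P.hparℓ * P.Lb3 := Nat.mul_comm _ _
  have hf3 : (2 : ℝ) ^ (a + b * P.hparℓ) ≤ P.𝔔3 := (pow_le_pow_right₀ (by norm_num) hab).trans P.two_pow_hLb3_le_𝔔3
  have hx : ((3 ^ (P.J₀3 - J) : ℕ) : ℝ) * s ≤ P.Xpt3 := by
    have := P.scale3_mul_le_Xpt3 hJ hs; push_cast at this ⊢; exact this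
  have hx0 : (0 : ℝ) ≤ ((3 ^ (P.J₀3 - J) : ℕ) : ℝ) * s := by positivity
  have hh := P.hpar_pos
  have hbase : 1 ≤ Real.exp 1 * (((3 ^ (P.J₀3 - J) : ℕ) : ℝ) * s + P.hparℓ) / P.hparℓ := by
    rw [le_div_iff₀ hh]; have := Real.exp_one_gt_two; nlinarith
  have hf4 : (Real.exp 1 * (((3 ^ (P.J₀3 - J) : ℕ) : ℝ) * s + P.hparℓ) / P.hparℓ) ^ (P.hparℓ * (b + 1)) ≤ P.𝔔3 := by
    calc (Real.exp 1 * (((3 ^ (P.J₀3 - J) : ℕ) : ℝ) * s + P.hparℓ) / P.hparℓ) ^ (P.hparℓ * (b + 1))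
        ≤ (Real.exp 1 * (((3 ^ (P.J₀3 - J) : ℕ) : ℝ) * s + P.hparℓ) / P.hparℓ) ^ (P.hparℓ * P.Lb3) := by
          refine pow_le_pow_right₀ hbase (Nat.mul_le_mul_left _ ?_); omega
      _ ≤ P.𝔔3 := P.ratio3_pow_le_𝔔3 hx0 hx
  push_cast at hf2 hf4 ⊢
  calc (τ₀.factorial : ℝ) * ((3 : ℝ) ^ (P.J₀3 - J)) ^ τ₀ *
        (2 ^ (a + b * P.hparℓ) * (Real.exp 1 * ((3 : ℝ) ^ (P.J₀3 - J) * s + P.hparℓ) / P.hparℓ) ^ (P.hparℓ * (b + 1)))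
      ≤ P.𝔔3 * P.𝔔3 * (P.𝔔3 * P.𝔔3) := by
        refine mul_le_mul (mul_le_mul hf1 hf2 (by positivity) h𝔔.le) (mul_le_mul hf3 hf4 (by positivity) h𝔔.le)
          (by positivity) (by positivity)
    _ = P.𝔔3 ^ 4 := by ring

end PadicW80ParL

end Summit.ABC.StewartYu

end
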